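import Literature.Geometry.Kaehler.ComplexTorusKugaSatake
import Literature.Geometry.Kaehler.ComplexTorusCupProductHodgeStructure
import Literature.Geometry.Kaehler.ComplexTorusKunnethHodgeStructure
import Literature.Geometry.Kaehler.ComplexTorusPoincareDualityHodgeStructure
import Literature.Geometry.Kaehler.ComplexTorusDualHodgeStructure
import Literature.AlgebraicGeometry.Motives.KugaSatakeOfExteriorSquare
import Literature.AlgebraicGeometry.Motives.GeometricVHSPolarizedTransport
import Literature.AlgebraicGeometry.Motives.KugaSatakeOfK3TypeFormFunctorial
import Mathlib.LinearAlgebra.Dual.Lemmas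
import HarnessLib

/-!
# The Plücker model of `(H¹(X, ℚ), H²(X, ℚ), ⟨ , ⟩)` for a two-dimensional complex torus

Layer `Literature/Geometry/Kaehler`, lane `lit-hodgefound` (Track 2 foundations library), Layer A1,
row **A1-39 FILE 3b** of `run/shared/lean/pub/lit-hodgefound/SKELETON.md` (seat `lit-hodgefound-skel-1`,
generation 12): the transport of the cohomology of a complex `2`-torus `X = E/Φ(ℤ^ι)` (`|ι| = 4`,
ordering `e : Fin 4 ≃ ι` of the lattice basis) to the linear-algebra model of
`LinearAlgebra/QuadraticForm/PluckerQuadricCliffordAlgebra` (FILE 1) in which Morrison's theorem is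
proved (`Motives/KugaSatakeOfExteriorSquare`, FILE 2c): `U = H¹(X, ℚ)^* = H₁(X, ℚ)` (the `ℚ`-dual
of the forms carrier `rationalForms Φ 1`) with the basis `b_e = (λ_{e 0}, …, λ_{e 3})` of homology
classes dual to `(dx_{e j})`, `V = U^* = H¹(X, ℚ)^{**} = H¹(X, ℚ)` (canonically, `Module.Dual.eval`),
`⋀²V =` alternating `2`-forms on `U` `= H²(X, ℚ)`. Everything stays in the universe of `E`.

Sources followed: Birkenhake–Lange / Lange, *Abelian Varieties over the Complex Numbers* (2023),
§1.1.3–1.1.4 (Lemma 1.1.17, Prop. 1.1.20: `H¹(X, ℤ) = Hom(Λ, ℤ)` with basis `dxₐ` dual to the lattice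
basis, `Hⁿ(X, ℤ) = ⋀ⁿ Hom(Λ, ℤ)`, the cup product is the exterior product, `dx_I(λ_J) = det`) and §6.2.4
(the cup-product pairing `⟨γ, δ⟩ = (γ ∧ δ)(λ_{e 0}, …, λ_{e 3})`); Huybrechts, *Lectures on K3 Surfaces*,
Ch. 4 §3.1 p. 83: "`H²(A, ℤ) ≅ ⋀² H¹(A, ℤ)` … the intersection form `q` on `H²`" is the pairing
`⋀²V × ⋀²V → ⋀⁴V ≅ ℤ`, i.e. the Plücker form.

## Main results (all proved, no named facts)

* `plucker_dualWedge_dualWedge_eq_det` (FILE 1's world, any field): `Q_b(φ₀ ∧ φ₁, φ₂ ∧ φ₃) =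
  det(φᵢ(bⱼ))` — the Plücker pairing of decomposable forms is the `4 × 4` determinant (Laplace
  expansion along two rows, the tree's `det_rows_four`).
* `homologyFrame Φ e : Basis (Fin 4) ℚ (H¹(X, ℚ)^*)`, `j ↦ λ_{e j} = ⟨·, λ_{e j}⟩` (the dual basis of
  `dx_{e j}`); `H¹(X, ℚ) → V = H¹(X, ℚ)^{**}` is `Module.Dual.eval` (`eval_coordOneForm_homologyFrame`).
* `twoFormModel Φ e : H²(X, ℚ) ≃ₗ[ℚ] (H¹(X, ℚ)^* [⋀^Fin 2]→ₗ[ℚ] ℚ)`, `dx_a ∧ dx_b ↦ dx_a ∧ dx_b` read as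
  an alternating form on homology, with
  **`poincarePairingRat_eq_plucker`**: `⟨γ, δ⟩_e = Q_{b_e}(γ', δ')` — the cup pairing of the torus IS
  the Plücker pairing (both are `det`: `dx_I(λ_J)` on one side, `det(φᵢ(bⱼ))` on the other);
  `intersectionQuad_eq_pluckerQuad` (`q_e = Q_{b_e} ∘ twoFormModel`), and
  **`twoFormModel_cupProduct`**: `(α ∪ β)' = α' ∧ β'` (the model is multiplicative in degree `1 + 1`).

* §5 `twoFormHodge Φ e` — `H²(X, ℚ)` with its Hodge structure read in the model (the tree's
  `HodgeStructure.comapEquiv`), `twoFormHodgeHom` (the model map is a morphism of Hodge structures,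
  filtrations corresponding: `comap_twoFormHodge_F`), `hodgeNumber_twoFormHodge`, and
  **`isKugaSatakeAdmissible_twoFormHodge`** (the model is Kuga–Satake admissible for `Q_{b_e}`);
* §6 **`kugaSatakeModelHom` / `kugaSatakeModelInv`**: `KS(X) ≅ KS(⋀²V, H²(X)', Q_{b_e})` as weight-one
  `ℚ`-Hodge structures (FILE 2d `kugaSatakeOfFormEquivHom` for the isometry `twoFormModel`).

* §7 `oneFormHodge Φ` (`H¹(X)` read on `V = U^*` along `Module.evalEquiv`, `oneFormHodgeHom`),
  Huybrechts' `α, β ∈ V^{1,0}`: `modelAlpha Φ e j = (eval ⊗ ℂ)(xⱼ)` for a basis `(x₀, x₁)` of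
  `H^{1,0}(X) = F¹H¹(X)` (`finrank_F_one_hodgeStructure_one : h^{1,0} = 2`), with
  `linearIndependent_modelAlpha`, **`oneFormHodge_F_one`** (`V^{1,0} = span{α, β}`), `oneFormHodge_F_two`,
  `baseChange_twoFormHodgeHom_cupProduct` (`(x ∪ y)' = x' ∧_ℂ y'`) and
  **`dualWedgeC_modelAlpha_mem_piece`** (`σ = α ∧ β ∈ (⋀²V)^{2,0}`, a cup product of `(1,0)`-classes);
* §8 `H¹(X̂) = H¹(X)^∨(-1)` on `U` (the tree's `twistedDual`, identified with the dual torus by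
  `dualCohomologyHom`): **`twistedDual_F_one`** (`F¹ = Ann{α, β}`), `twistedDual_F_two`;
* §9 **Morrison's theorem for the torus** (Huybrechts Prop. 3.1 as an isomorphism of rational Hodge
  structures): `modelEndPairHom/Inv` (FILE 2c's `Ψ⁺` for the model) and
  **`morrisonHom Φ e : Hom (kugaSatake Φ e) (endPairHodgeStructure (oneFormHodge Φ) H¹(X)^∨(-1))`**,
  **`morrisonInv`**, `morrisonInv_morrisonHom_apply`, `morrisonHom_morrisonInv_apply`:
  `KS(X) ≅ Hom(V_triv, H¹(X)) ⊕ Hom(U_triv, H¹(X̂)) ≅ (H¹(X) ⊕ H¹(X̂))⁴`, i.e. `KS(A) ∼ (A × Â)⁴`.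

## References

* [Lange2023AbelianVarietiesComplex] H. Lange, *Abelian Varieties over the Complex Numbers* (2023),
  §1.1.3 Lemma 1.1.17, §1.1.4 Prop. 1.1.20, §6.2.4.
* [Huybrechts2016K3] D. Huybrechts, *Lectures on K3 Surfaces* (2016), Ch. 4 §3.1 (PDF p. 83).
-/

noncomputable section

open scoped TensorProduct
open Module Literature.AlgebraicGeometry.Motives Literature.Analysis.Complex
open Literature.LinearAlgebra.Alternating Literature.LinearAlgebra.QuadraticForm.PluckerClifford

namespace Literature.Geometry.Kaehler

namespace ComplexTorus

/-- `2 + 2 = 4` (degree bookkeeping for the cup pairing `H² × H² → H⁴`). [folklore] -/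
private theorem two_add_two : 2 + 2 = 4 := rfl

/-! ### §0 The Plücker pairing of decomposable forms is a determinant -/

section Det

variable {K : Type*} [Field K] {U : Type*} [AddCommGroup U] [Module K U] (b : Basis (Fin 4) K U)

/-- **`Q_b(φ₀ ∧ φ₁, φ₂ ∧ φ₃) = det(φᵢ(bⱼ))`**: the Plücker pairing of two decomposable `2`-forms is the
`4 × 4` determinant of the values of the covectors on the frame — `(φ₀ ∧ φ₁ ∧ φ₂ ∧ φ₃)(b₀, …, b₃)`
(Laplace expansion along the first two rows = the six-term shuffle formula defining `plucker`).
[cite: Huybrechts2016K3, Ch. 4 §3.1, proof of Prop. 3.1] -/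
theorem plucker_dualWedge_dualWedge_eq_det (φ₀ φ₁ φ₂ φ₃ : Module.Dual K U) :
    plucker b (dualWedge φ₀ φ₁) (dualWedge φ₂ φ₃) =
      (Matrix.of ![fun j ↦ φ₀ (b j), fun j ↦ φ₁ (b j), fun j ↦ φ₂ (b j), fun j ↦ φ₃ (b j)]).det := by
  rw [det_rows_four, plucker_apply]
  simp only [dualWedge_apply]

end Det

universe uE

variable {ι : Type*} [Fintype ι] [LinearOrder ι] {E : Type uE} [NormedAddCommGroup E] [NormedSpace ℂ E]
  (Φ : (ι → ℝ) ≃L[ℝ] E)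

/-! ### §1 `U = H¹(X, ℚ)^* = H₁(X, ℚ)` with the homology frame `λ_{e j}` -/

/-- **The homology frame `b_e = (λ_{e 0}, …, λ_{e 3})`** of `U = H¹(X, ℚ)^* = H₁(X, ℚ)`: the basis dual
to the coordinate one-forms `(dx_{e j})` (Lange, Lemma 1.1.17 / Prop. 1.1.20: `H¹(X, ℤ) = Hom(Λ, ℤ)`,
the `dxₐ` dual to the lattice basis `λₐ`; "fix a basis `λ₁, …, λ_{2g}` of `Λ`").
[cite: Lange2023AbelianVarietiesComplex, §1.1.4 Prop. 1.1.20] -/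
def homologyFrame (e : Fin 4 ≃ ι) : Basis (Fin 4) ℚ (Module.Dual ℚ (rationalForms Φ 1)) :=
  (coordOneFormBasis Φ).dualBasis.reindex e.symm

/-- `λ_{e j} = ⟨·, λ_{e j}⟩` is the coordinate functional of `dx_{e j}`.
[cite: Lange2023AbelianVarietiesComplex, §1.1.4 Prop. 1.1.20] -/
theorem homologyFrame_apply (e : Fin 4 ≃ ι) (j : Fin 4) :
    homologyFrame Φ e j = (coordOneFormBasis Φ).coord (e j) := by
  rw [homologyFrame, Basis.reindex_apply, Equiv.symm_symm, Basis.coe_dualBasis]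

/-- **Duality `dxₐ(λ_{e j}) = δ_{a, e j}`**, read through `V = U^*`: the double-dual image of `dxₐ`
evaluated on the frame vector `λ_{e j}`. [cite: Lange2023AbelianVarietiesComplex, §1.1.4 Prop. 1.1.20] -/
theorem homologyFrame_apply_coordOneForm (e : Fin 4 ≃ ι) (j : Fin 4) (a : ι) :
    homologyFrame Φ e j (coordOneForm Φ a) = if a = e j then 1 else 0 := by
  rw [homologyFrame_apply, ← coordOneFormBasis_apply, Basis.coord_apply, Basis.repr_self,
    Finsupp.single_apply]

/-- The same through `V = U^{**}`: the double-dual image of `dxₐ` evaluated on `λ_{e j}`.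
[cite: Lange2023AbelianVarietiesComplex, §1.1.4 Prop. 1.1.20] -/
theorem eval_coordOneForm_homologyFrame (e : Fin 4 ≃ ι) (a : ι) (j : Fin 4) :
    Module.Dual.eval ℚ (rationalForms Φ 1) (coordOneForm Φ a) (homologyFrame Φ e j) =
      if a = e j then 1 else 0 := by
  rw [Module.Dual.eval_apply, homologyFrame_apply_coordOneForm]

/-! ### §2 `H²(X, ℚ) ≅ ⋀²V`: `dx_a ∧ dx_b ↦ dx_a ∧ dx_b` as an alternating form on `U` -/

/-- The model of `H²(X, ℚ)` as a linear map: the lattice monomial `dx_{w 0} ∧ dx_{w 1}` of an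
increasing word goes to the decomposable form `dx_{w 0} ∧ dx_{w 1}` on `U = H₁(X, ℚ)` (through `V = U^*`) (Lange, Prop. 1.1.20:
`H²(X, ℤ) = ⋀² Hom(Λ, ℤ)` with basis the `dx_I`). [cite: Lange2023AbelianVarietiesComplex, §1.1.4 Prop. 1.1.20] -/
def twoFormModelₗ :
    rationalForms Φ 2 →ₗ[ℚ] (Module.Dual ℚ (rationalForms Φ 1) [⋀^Fin 2]→ₗ[ℚ] ℚ) :=
  (monomialBasis Φ 2).constr ℚ fun w ↦
    dualWedge (Module.Dual.eval ℚ _ (coordOneForm Φ (w.1 0)))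
      (Module.Dual.eval ℚ _ (coordOneForm Φ (w.1 1)))

/-- On the monomial basis: `dx_{w 0} ∧ dx_{w 1} ↦ dx_{w 0} ∧ dx_{w 1}`.
[cite: Lange2023AbelianVarietiesComplex, §1.1.4 Prop. 1.1.20] -/
theorem twoFormModelₗ_monomialBasis (w : {w : Fin 2 → ι // StrictMono w}) :
    twoFormModelₗ Φ (monomialBasis Φ 2 w) =
      dualWedge (Module.Dual.eval ℚ _ (coordOneForm Φ (w.1 0)))
        (Module.Dual.eval ℚ _ (coordOneForm Φ (w.1 1))) := by
  rw [twoFormModelₗ, Basis.constr_basis]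

/-! ### §3 The cup pairing is the Plücker pairing -/

section Pairing

omit [Fintype ι] [LinearOrder ι] in
/-- Concatenation of two `2`-letter words as a `4`-tuple. [folklore] -/
private theorem append_eq_vec (w w' : Fin 2 → ι) :
    (Fin.append w w' : Fin 4 → ι) = ![w 0, w 1, w' 0, w' 1] := by
  funext i
  fin_cases i <;> rfl

/-- **`⟨dx_w, dx_{w'}⟩_e = Q_{b_e}(x_w, x_{w'})` on monomials**: both equal the `4 × 4` determinant
`det(δ_{u i, e j})` of the word `u = w w'` — `dx_u(λ_{e 0}, …, λ_{e 3}) = det(x_{u i}(λ_{e j}))` (Lange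
Prop. 1.1.20) on the torus side, `plucker_dualWedge_dualWedge_eq_det` on the model side.
[cite: Lange2023AbelianVarietiesComplex, §1.1.4 Prop. 1.1.20 and §6.2.4] -/
theorem poincarePairingRat_monomialBasis_eq_plucker (e : Fin 4 ≃ ι)
    (w w' : {w : Fin 2 → ι // StrictMono w}) :
    poincarePairingRat Φ e two_add_two (monomialBasis Φ 2 w) (monomialBasis Φ 2 w') =
      plucker (homologyFrame Φ e) (twoFormModelₗ Φ (monomialBasis Φ 2 w))
        (twoFormModelₗ Φ (monomialBasis Φ 2 w')) := by
  have hw : monomialBasis Φ 2 w = ⟨latMonomial Φ 2 w.1, latMonomial_mem_rationalForms Φ 2 w.1⟩ :=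
    Subtype.ext (coe_monomialBasis Φ w)
  have hw' : monomialBasis Φ 2 w' = ⟨latMonomial Φ 2 w'.1, latMonomial_mem_rationalForms Φ 2 w'.1⟩ :=
    Subtype.ext (coe_monomialBasis Φ w')
  have hdet : ∀ M : Matrix (Fin 4) (Fin 4) ℚ, (((M.det : ℚ)) : ℂ) = (M.map (fun x : ℚ ↦ (x : ℂ))).det :=
    fun M ↦ by simpa using RingHom.map_det (Rat.castHom ℂ) M
  apply Rat.cast_injective (α := ℂ)
  rw [twoFormModelₗ_monomialBasis, twoFormModelₗ_monomialBasis, plucker_dualWedge_dualWedge_eq_det,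
    hdet, hw, hw', poincarePairingRat_latMonomial, finCongr_refl, Equiv.refl_trans, Rat.cast_intCast,
    ← latMonomial_apply_orderedBasis Φ e, latMonomial_apply_eq_det_coord, append_eq_vec]
  congr 1
  ext i j
  fin_cases i <;>
    simp [Matrix.map_apply, orderedBasis_apply, Pi.single_apply, homologyFrame_apply_coordOneForm] <;>
    split_ifs <;> simp

/-- **The cup pairing of the `2`-torus IS the Plücker pairing**: `⟨γ, δ⟩_e = Q_{b_e}(γ', δ')` for all
`γ, δ ∈ H²(X, ℚ)` — Huybrechts' "`H²(A, ℤ) ≅ ⋀² H¹(A, ℤ)` … the intersection form" on `H²` is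
`⋀²V × ⋀²V → ⋀⁴V ≅ ℤ` (both sides bilinear; `poincarePairingRat_monomialBasis_eq_plucker` on the basis).
[cite: Huybrechts2016K3, Ch. 4 §3.1 (PDF p. 83)] [cite: Lange2023AbelianVarietiesComplex, §6.2.4] -/
theorem poincarePairingRat_eq_plucker (e : Fin 4 ≃ ι) (γ δ : rationalForms Φ 2) :
    poincarePairingRat Φ e two_add_two γ δ =
      plucker (homologyFrame Φ e) (twoFormModelₗ Φ γ) (twoFormModelₗ Φ δ) := by
  have h : poincarePairingRat Φ e two_add_two =
      (plucker (homologyFrame Φ e)).compl₁₂ (twoFormModelₗ Φ) (twoFormModelₗ Φ) :=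
    LinearMap.ext_basis (monomialBasis Φ 2) (monomialBasis Φ 2) fun w w' ↦ by
      rw [LinearMap.compl₁₂_apply]
      exact poincarePairingRat_monomialBasis_eq_plucker Φ e w w'
  rw [h, LinearMap.compl₁₂_apply]

/-- The model map is injective (the cup pairing is non-degenerate on `H²(X, ℚ)`,
`poincareDualHom_bijective`). [cite: Lange2023AbelianVarietiesComplex, §6.2.4] -/
theorem twoFormModelₗ_injective (e : Fin 4 ≃ ι) : Function.Injective (twoFormModelₗ Φ) := by
  rw [injective_iff_map_eq_zero]
  intro γ hγ
  -- non-degeneracy of the cup pairing, in the form `poincareDualHom_bijective` (A1-25)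
  haveI : HodgeTensorFacts.{uE, uE} := hodgeTensorFacts_holds
  have hbij := poincareDualHom_bijective Φ e two_add_two two_add_two
  apply hbij.1
  rw [map_zero, poincareDualHom_toLinearMap]
  refine LinearMap.ext fun δ ↦ ?_
  rw [poincarePairingRat_eq_plucker, hγ, map_zero, LinearMap.zero_apply, LinearMap.zero_apply]

/-- The two carriers have the same dimension `6`. [cite: Huybrechts2016K3, Ch. 4 §3.1, proof of Prop. 3.1] -/
theorem finrank_rationalForms_two_eq_finrank_twoForms (e : Fin 4 ≃ ι) :
    finrank ℚ (rationalForms Φ 2) =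
      finrank ℚ (Module.Dual ℚ (rationalForms Φ 1) [⋀^Fin 2]→ₗ[ℚ] ℚ) := by
  rw [finrank_rationalForms_two Φ e, finrank_twoForms (homologyFrame Φ e)]

/-- **The model of `H²(X, ℚ)`**: the `ℚ`-linear isomorphism `H²(X, ℚ) ≅ ⋀²V` (alternating
`2`-forms on `U = H₁(X, ℚ)`), `dx_a ∧ dx_b ↦ dx_a ∧ dx_b` (Lange, Prop. 1.1.20: `H²(X, ℤ) = ⋀² Hom(Λ, ℤ)`;
Huybrechts: `H²(A, ℤ) ≅ ⋀² H¹(A, ℤ)`). [cite: Lange2023AbelianVarietiesComplex, §1.1.4 Prop. 1.1.20]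
[cite: Huybrechts2016K3, Ch. 4 §3.1 (PDF p. 83)] -/
def twoFormModel (e : Fin 4 ≃ ι) :
    rationalForms Φ 2 ≃ₗ[ℚ] (Module.Dual ℚ (rationalForms Φ 1) [⋀^Fin 2]→ₗ[ℚ] ℚ) :=
  LinearEquiv.ofBijective (twoFormModelₗ Φ)
    ⟨twoFormModelₗ_injective Φ e, by
      haveI := finiteDimensional_twoForms (homologyFrame Φ e)
      exact (LinearMap.injective_iff_surjective_of_finrank_eq_finrank (V := rationalForms Φ 2)
        (V₂ := Module.Dual ℚ (rationalForms Φ 1) [⋀^Fin 2]→ₗ[ℚ] ℚ)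
        (finrank_rationalForms_two_eq_finrank_twoForms Φ e)).1 (twoFormModelₗ_injective Φ e)⟩

/-- `twoFormModel` is `twoFormModelₗ`. [cite: Lange2023AbelianVarietiesComplex, §1.1.4 Prop. 1.1.20] -/
@[simp]
theorem twoFormModel_apply (e : Fin 4 ≃ ι) (γ : rationalForms Φ 2) : twoFormModel Φ e γ = twoFormModelₗ Φ γ := rfl

/-- The underlying linear map of `twoFormModel` is `twoFormModelₗ`. [cite: Lange2023AbelianVarietiesComplex, §1.1.4 Prop. 1.1.20] -/
theorem twoFormModel_toLinearMap (e : Fin 4 ≃ ι) :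
    (twoFormModel Φ e).toLinearMap = twoFormModelₗ Φ := rfl

-- `twoFormModel` is built with `LinearEquiv.ofBijective`; keep definitional unfolding from exploring
-- its (choice-laden) inverse: all later uses go through `twoFormModel_apply` / `_toLinearMap`.
attribute [irreducible] twoFormModel

/-- **The intersection form is the Plücker form**: `q_e(γ) = Q_{b_e}(γ')`.
[cite: Huybrechts2016K3, Ch. 4 §3.1 (PDF p. 83)] -/
theorem pluckerQuad_twoFormModel (e : Fin 4 ≃ ι) (γ : rationalForms Φ 2) :
    pluckerQuad (homologyFrame Φ e) (twoFormModel Φ e γ) = intersectionQuad Φ e γ := by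
  rw [pluckerQuad_apply, twoFormModel_apply, ← poincarePairingRat_eq_plucker]
  rfl

/-- The same as an identity of quadratic maps: `q_e = Q_{b_e} ∘ twoFormModel`.
[cite: Huybrechts2016K3, Ch. 4 §3.1 (PDF p. 83)] -/
theorem pluckerQuad_comp_twoFormModel (e : Fin 4 ≃ ι) :
    (pluckerQuad (homologyFrame Φ e)).comp (twoFormModel Φ e).toLinearMap = intersectionQuad Φ e :=
  QuadraticMap.ext fun γ ↦ pluckerQuad_twoFormModel Φ e γ

/-- `twoFormModel` is a similarity of unit multiplier `1` (an isometry) `(H²(X, ℚ), q_e) → (⋀²V, Q_b)`,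
in the form consumed by `KugaSatake.evenEquivOfSimilar`. [cite: Huybrechts2016K3, Ch. 4 §3.1 (PDF p. 83)] -/
theorem pluckerQuad_twoFormModel_eq_one_mul (e : Fin 4 ≃ ι) (γ : rationalForms Φ 2) :
    pluckerQuad (homologyFrame Φ e) (twoFormModel Φ e γ) = ((1 : ℚˣ) : ℚ) * intersectionQuad Φ e γ := by
  rw [pluckerQuad_twoFormModel, Units.val_one, one_mul]

end Pairing

/-! ### §4 The model is multiplicative: `(α ∪ β)' = α' ∧ β'` -/

section Cup

omit [Fintype ι] [LinearOrder ι] in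
/-- `dxₐ ∧ dxₐ = 0`. [cite: Lange2023AbelianVarietiesComplex, §1.1.4 Prop. 1.1.20] -/
private theorem latMonomial_pair_self (a : ι) : latMonomial Φ 2 ![a, a] = 0 :=
  wedgeWord_eq_zero_of_not_injective _ _ _ fun h ↦ by
    have := h (show ![a, a] 0 = ![a, a] 1 from rfl)
    exact absurd this (by decide)

omit [Fintype ι] [LinearOrder ι] in
/-- `dx_b ∧ dxₐ = -dxₐ ∧ dx_b`. [cite: Lange2023AbelianVarietiesComplex, §1.1.4 Prop. 1.1.20] -/
private theorem latMonomial_pair_swap (a a' : ι) : latMonomial Φ 2 ![a', a] = -latMonomial Φ 2 ![a, a'] := by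
  have h : (![a', a] : Fin 2 → ι) = ![a, a'] ∘ Equiv.swap (0 : Fin 2) 1 := by
    funext i
    fin_cases i <;> simp [Equiv.swap_apply_left, Equiv.swap_apply_right]
  rw [h, latMonomial_eq, latMonomial_eq, wedgeWord_comp_swap _ _ _ (show (0 : Fin 2) ≠ 1 by decide)]

omit [Fintype ι] in
/-- `![a, a']` is increasing iff `a < a'`. [folklore] -/
private theorem strictMono_pair {a a' : ι} (h : a < a') : StrictMono ![a, a'] := by
  rw [Fin.strictMono_iff_lt_succ]
  intro i
  fin_cases i
  simpa using h

/-- **The model on ALL lattice pairs**: `dxₐ ∧ dx_{a'} ↦ dxₐ ∧ dx_{a'}` for any `a, a'` (not only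
increasing words: both sides vanish for `a = a'` and are antisymmetric).
[cite: Lange2023AbelianVarietiesComplex, §1.1.4 Prop. 1.1.20] -/
theorem twoFormModelₗ_latMonomial_pair (a a' : ι) :
    twoFormModelₗ Φ ⟨latMonomial Φ 2 ![a, a'], latMonomial_mem_rationalForms Φ 2 _⟩ =
      dualWedge (Module.Dual.eval ℚ _ (coordOneForm Φ a)) (Module.Dual.eval ℚ _ (coordOneForm Φ a')) := by
  rcases lt_trichotomy a a' with h | rfl | h
  · have hb : (⟨latMonomial Φ 2 ![a, a'], latMonomial_mem_rationalForms Φ 2 _⟩ : rationalForms Φ 2) =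
        monomialBasis Φ 2 ⟨![a, a'], strictMono_pair h⟩ :=
      Subtype.ext (coe_monomialBasis Φ ⟨![a, a'], strictMono_pair h⟩).symm
    rw [hb, twoFormModelₗ_monomialBasis]
    rfl
  · have hb : (⟨latMonomial Φ 2 ![a, a], latMonomial_mem_rationalForms Φ 2 _⟩ : rationalForms Φ 2) = 0 :=
      Subtype.ext (latMonomial_pair_self Φ a)
    rw [hb, map_zero, dualWedge_self]
  · have hb : (⟨latMonomial Φ 2 ![a, a'], latMonomial_mem_rationalForms Φ 2 _⟩ : rationalForms Φ 2) =
        (-1 : ℚ) • monomialBasis Φ 2 ⟨![a', a], strictMono_pair h⟩ := by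
      apply Subtype.ext
      change latMonomial Φ 2 ![a, a'] = _
      rw [Submodule.coe_smul, coe_monomialBasis, neg_one_smul]
      exact latMonomial_pair_swap Φ a' a
    rw [hb, map_smul, twoFormModelₗ_monomialBasis]
    change (-1 : ℚ) • dualWedge (Module.Dual.eval ℚ _ (coordOneForm Φ a'))
      (Module.Dual.eval ℚ _ (coordOneForm Φ a)) = _
    rw [neg_one_smul, dualWedge_swap, neg_neg]

omit [Fintype ι] [LinearOrder ι] in
/-- `dxₐ ∪ dx_{a'} = dxₐ ∧ dx_{a'}` as a class. [cite: Lange2023AbelianVarietiesComplex, §1.1.4 Prop. 1.1.20] -/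
theorem cupProduct_coordOneForm (h : 1 + 1 = 2) (a a' : ι) :
    cupProduct Φ h (coordOneForm Φ a) (coordOneForm Φ a') =
      ⟨latMonomial Φ 2 ![a, a'], latMonomial_mem_rationalForms Φ 2 _⟩ := by
  apply Subtype.ext
  rw [coe_cupProduct, coe_coordOneForm, coe_coordOneForm, latMonomial_wedge_latMonomial]
  have happ : (Fin.append (fun _ : Fin 1 ↦ a) (fun _ : Fin 1 ↦ a') : Fin 2 → ι) = ![a, a'] := by
    funext i
    fin_cases i <;> rfl
  rw [finCongr_refl, ContinuousAlternatingMap.domDomCongr_refl, happ]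

/-- **The model is multiplicative in degree `1 + 1`**: `(α ∪ β)' = α' ∧ β'` for all
`α, β ∈ H¹(X, ℚ)` (Lange, Prop. 1.1.20: the cup product on `H•(X, ℤ) = ⋀• Hom(Λ, ℤ)` is the exterior
product; Huybrechts: `H²(A, ℤ) ≅ ⋀² H¹(A, ℤ)`). [cite: Lange2023AbelianVarietiesComplex, §1.1.4 Prop. 1.1.20]
[cite: Huybrechts2016K3, Ch. 4 §3.1 (PDF p. 83)] -/
theorem twoFormModelₗ_cupProduct (h : 1 + 1 = 2) (α β : rationalForms Φ 1) :
    twoFormModelₗ Φ (cupProduct Φ h α β) =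
      dualWedge (Module.Dual.eval ℚ _ α) (Module.Dual.eval ℚ _ β) := by
  have key : (cupProduct Φ h).compr₂ (twoFormModelₗ Φ) =
      (HodgeStructure.MorrisonSpinor.dualWedgeBilin (U := Module.Dual ℚ (rationalForms Φ 1))).compl₁₂
        (Module.Dual.eval ℚ (rationalForms Φ 1)) (Module.Dual.eval ℚ (rationalForms Φ 1)) :=
    LinearMap.ext_basis (coordOneFormBasis Φ) (coordOneFormBasis Φ) fun a a' ↦ by
      rw [LinearMap.compr₂_apply, LinearMap.compl₁₂_apply, coordOneFormBasis_apply,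
        coordOneFormBasis_apply, cupProduct_coordOneForm, twoFormModelₗ_latMonomial_pair,
        HodgeStructure.MorrisonSpinor.dualWedgeBilin_apply]
  have := LinearMap.congr_fun (LinearMap.congr_fun key α) β
  rw [LinearMap.compr₂_apply, LinearMap.compl₁₂_apply] at this
  rw [this]
  rfl

/-- The same for the linear equivalence. [cite: Lange2023AbelianVarietiesComplex, §1.1.4 Prop. 1.1.20] -/
theorem twoFormModel_cupProduct (e : Fin 4 ≃ ι) (h : 1 + 1 = 2) (α β : rationalForms Φ 1) :
    twoFormModel Φ e (cupProduct Φ h α β) =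
      dualWedge (Module.Dual.eval ℚ _ α) (Module.Dual.eval ℚ _ β) := by
  rw [twoFormModel_apply]
  exact twoFormModelₗ_cupProduct Φ h α β

end Cup

/-! ### §5 The Hodge structure of `H²(X, ℚ)` in the model -/

section Hodge


/-- **`H²(X, ℚ)` with its weight-two Hodge structure, read in the model `⋀²V`**: the transport of
the tree's `hodgeStructure Φ 2` along `twoFormModel` (the tree's `HodgeStructure.comapEquiv`:
`F^p = (twoFormModel⁻¹)_ℂ⁻¹ F^p H²(X)`). [cite: Huybrechts2016K3, Ch. 4 §3.1 (PDF p. 83)] -/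
def twoFormHodge (e : Fin 4 ≃ ι) :
    HodgeStructure (Module.Dual ℚ (rationalForms Φ 1) [⋀^Fin 2]→ₗ[ℚ] ℚ) 2 :=
  (hodgeStructure Φ 2).comapEquiv (twoFormModel Φ e).symm

/-- **`twoFormModel : H²(X, ℚ) → ⋀²V` is a morphism (indeed an isomorphism) of weight-two Hodge
structures** onto the model (the filtrations correspond: `HodgeStructure.comapEquiv_comapEquiv_symm`).
[cite: Huybrechts2016K3, Ch. 4 §3.1 (PDF p. 83)] -/
def twoFormHodgeHom (e : Fin 4 ≃ ι) : HodgeStructure.Hom (hodgeStructure Φ 2) (twoFormHodge Φ e) :=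
  HodgeStructure.Hom.ofComapBaseChange (twoFormModel Φ e) fun p ↦
    congrArg (fun H : HodgeStructure (rationalForms Φ 2) 2 ↦ H.F p)
      (HodgeStructure.comapEquiv_comapEquiv_symm (hodgeStructure Φ 2) (twoFormModel Φ e))

/-- Its underlying map is `twoFormModel`. [cite: Huybrechts2016K3, Ch. 4 §3.1 (PDF p. 83)] -/
theorem twoFormHodgeHom_toLinearMap_apply (e : Fin 4 ≃ ι) (γ : rationalForms Φ 2) :
    (twoFormHodgeHom Φ e).toLinearMap γ = twoFormModel Φ e γ :=
  rfl

/-- The filtrations correspond under `twoFormModel_ℂ`: `(twoFormModel_ℂ)⁻¹ F^p(model) = F^p H²(X)`.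
[cite: Huybrechts2016K3, Ch. 4 §3.1 (PDF p. 83)] -/
theorem comap_twoFormHodge_F (e : Fin 4 ≃ ι) (p : ℤ) :
    ((twoFormHodge Φ e).F p).comap ((twoFormHodgeHom Φ e).toLinearMap.baseChange ℂ) =
      (hodgeStructure Φ 2).F p :=
  congrArg (fun H : HodgeStructure (rationalForms Φ 2) 2 ↦ H.F p)
    (HodgeStructure.comapEquiv_comapEquiv_symm (hodgeStructure Φ 2) (twoFormModel Φ e))

/-- `twoFormModel_ℂ` is surjective (base change of a surjection). [folklore] -/
private theorem baseChange_twoFormHodgeHom_surjective (e : Fin 4 ≃ ι) :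
    Function.Surjective ((twoFormHodgeHom Φ e).toLinearMap.baseChange ℂ) := by
  rw [LinearMap.baseChange_eq_ltensor]
  exact LinearMap.lTensor_surjective ℂ (twoFormModel Φ e).surjective

/-- `twoFormModel_ℂ` is injective (`ℂ` is flat over `ℚ`). [folklore] -/
private theorem baseChange_twoFormHodgeHom_injective (e : Fin 4 ≃ ι) :
    Function.Injective ((twoFormHodgeHom Φ e).toLinearMap.baseChange ℂ) := by
  rw [LinearMap.baseChange_eq_ltensor]
  exact Module.Flat.lTensor_preserves_injective_linearMap _ (twoFormModel Φ e).injective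

/-- The Hodge pieces of the model are the images of those of `H²(X)`:
`model^{p,q} = twoFormModel_ℂ(H^{p,q}(X))`. [cite: Huybrechts2016K3, Ch. 4 §3.1 (PDF p. 83)] -/
theorem map_piece_eq_twoFormHodge_piece (e : Fin 4 ≃ ι) (p q : ℤ) :
    ((hodgeStructure Φ 2).piece p q).map ((twoFormHodgeHom Φ e).toLinearMap.baseChange ℂ) =
      (twoFormHodge Φ e).piece p q :=
  HodgeStructure.map_piece_eq_of_comap_F_eq (hodgeStructure Φ 2) (twoFormHodge Φ e) rfl
    (twoFormHodgeHom Φ e).toLinearMap (baseChange_twoFormHodgeHom_surjective Φ e)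
    (comap_twoFormHodge_F Φ e) p q

/-- **The Hodge numbers are unchanged in the model**: `h^{p,q}(model) = h^{p,q}(X)`.
[cite: Huybrechts2016K3, Ch. 4 §3.1 (PDF p. 83)] -/
theorem hodgeNumber_twoFormHodge (e : Fin 4 ≃ ι) (p q : ℤ) :
    (twoFormHodge Φ e).hodgeNumber p q = (hodgeStructure Φ 2).hodgeNumber p q := by
  unfold HodgeStructure.hodgeNumber
  rw [← map_piece_eq_twoFormHodge_piece Φ e p q]
  exact (Submodule.equivMapOfInjective ((twoFormHodgeHom Φ e).toLinearMap.baseChange ℂ)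
    (baseChange_twoFormHodgeHom_injective Φ e) ((hodgeStructure Φ 2).piece p q)).finrank_eq.symm

/-- `h^{2,0}(model) = 1`. [cite: Huybrechts2016K3, Ch. 4 §3.1 (PDF p. 83)] -/
theorem hodgeNumber_twoFormHodge_two_zero (e : Fin 4 ≃ ι) :
    (twoFormHodge Φ e).hodgeNumber 2 0 = 1 := by
  rw [hodgeNumber_twoFormHodge, hodgeNumber_two_zero Φ e]

/-- **The model is Kuga–Satake admissible for the Plücker form**: `(⋀²V, H²(X)', Q_{b_e})` satisfies
`h^{2,0} = 1`, `Q(σ) = 0`, `Q(σ, σ̄) ≠ 0` — transported from the torus (`isKugaSatakeAdmissible_hodgeStructure_two`,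
FILE 3) along the isometry `twoFormModel` (`IsKugaSatakeAdmissible.of_similar`).
[cite: Huybrechts2016K3, Ch. 4 §2.5 and Rem. 2.3] -/
theorem isKugaSatakeAdmissible_twoFormHodge (e : Fin 4 ≃ ι) :
    (twoFormHodge Φ e).IsKugaSatakeAdmissible (pluckerQuad (homologyFrame Φ e)) :=
  (isKugaSatakeAdmissible_hodgeStructure_two Φ e).of_similar (intersectionQuad Φ e)
    (pluckerQuad (homologyFrame Φ e)) (hodgeNumber_twoFormHodge_two_zero Φ e) (twoFormHodgeHom Φ e)
    (twoFormModel Φ e).injective one_ne_zero fun γ ↦ by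
      rw [twoFormHodgeHom_toLinearMap_apply, pluckerQuad_twoFormModel, one_mul]

end Hodge

/-! ### §6 `KS(X) ≅ KS(⋀²V, Q_{b_e})`: the Kuga–Satake structure of the torus in the Plücker model -/

section KugaSatake

set_option maxHeartbeats 800000 in
/-- **`KS(X) → KS(⋀²V, H²(X)', Q_{b_e})` is a morphism of weight-one Hodge structures** — the
even-Clifford map `ψ_Cl` of the isometry `twoFormModel : (H²(X, ℚ), q_e) ≅ (⋀²V, Q_{b_e})`
(FILE 2d `kugaSatakeOfFormEquivHom`; Varesco Lemma 3.3 / Huybrechts §2.5: the Kuga–Satake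
construction applied to `H²` of a two-dimensional complex torus, read in the model of Prop. 3.1).
The instance paths of the torus carriers (`Submodule.addCommMonoid`) and of the generic lemma
(`AddCommGroup.toAddCommMonoid`) are reconciled by definitional unfolding, whence the raised
heartbeat budget. [cite: Huybrechts2016K3, Ch. 4 §2.5 and §3.1 Prop. 3.1] -/
def kugaSatakeModelHom (e : Fin 4 ≃ ι) :
    HodgeStructure.Hom (kugaSatake Φ e)
      (HodgeStructure.kugaSatakeOfForm (twoFormHodge Φ e) (pluckerQuad (homologyFrame Φ e))
        (isKugaSatakeAdmissible_twoFormHodge Φ e)) :=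
  HodgeStructure.kugaSatakeOfFormEquivHom (H := hodgeStructure Φ 2) (H' := twoFormHodge Φ e)
    (intersectionQuad Φ e) (pluckerQuad (homologyFrame Φ e))
    (twoFormModel Φ e) 1 (pluckerQuad_twoFormModel_eq_one_mul Φ e) (comap_twoFormHodge_F Φ e)
    (isKugaSatakeAdmissible_hodgeStructure_two Φ e) (isKugaSatakeAdmissible_twoFormHodge Φ e)

set_option maxHeartbeats 800000 in
/-- The inverse morphism `KS(⋀²V, Q_{b_e}) → KS(X)`. [cite: Huybrechts2016K3, Ch. 4 §2.5 and §3.1 Prop. 3.1] -/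
def kugaSatakeModelInv (e : Fin 4 ≃ ι) :
    HodgeStructure.Hom
      (HodgeStructure.kugaSatakeOfForm (twoFormHodge Φ e) (pluckerQuad (homologyFrame Φ e))
        (isKugaSatakeAdmissible_twoFormHodge Φ e)) (kugaSatake Φ e) :=
  HodgeStructure.kugaSatakeOfFormEquivInv (H := hodgeStructure Φ 2) (H' := twoFormHodge Φ e)
    (intersectionQuad Φ e) (pluckerQuad (homologyFrame Φ e))
    (twoFormModel Φ e) 1 (pluckerQuad_twoFormModel_eq_one_mul Φ e) (comap_twoFormHodge_F Φ e)
    (isKugaSatakeAdmissible_hodgeStructure_two Φ e) (isKugaSatakeAdmissible_twoFormHodge Φ e)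

set_option maxHeartbeats 800000 in
/-- **`KS(X) ≅ KS(⋀²V, Q_{b_e})` as weight-one `ℚ`-Hodge structures**: `inv ∘ hom = id`.
[cite: Huybrechts2016K3, Ch. 4 §2.5 and §3.1 Prop. 3.1] -/
theorem kugaSatakeModelInv_hom_apply (e : Fin 4 ≃ ι)
    (z : CliffordAlgebra.even (M := rationalForms Φ 2) (intersectionQuad Φ e)) :
    (kugaSatakeModelInv Φ e).toLinearMap ((kugaSatakeModelHom Φ e).toLinearMap z) = z :=
  HodgeStructure.kugaSatakeOfFormEquivInv_hom_apply (H := hodgeStructure Φ 2) (H' := twoFormHodge Φ e)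
    (intersectionQuad Φ e) (pluckerQuad (homologyFrame Φ e))
    (twoFormModel Φ e) 1 (pluckerQuad_twoFormModel_eq_one_mul Φ e) (comap_twoFormHodge_F Φ e)
    (isKugaSatakeAdmissible_hodgeStructure_two Φ e) (isKugaSatakeAdmissible_twoFormHodge Φ e) z

set_option maxHeartbeats 800000 in
/-- `hom ∘ inv = id`. [cite: Huybrechts2016K3, Ch. 4 §2.5 and §3.1 Prop. 3.1] -/
theorem kugaSatakeModelHom_inv_apply (e : Fin 4 ≃ ι)
    (z : CliffordAlgebra.even (pluckerQuad (homologyFrame Φ e))) :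
    (kugaSatakeModelHom Φ e).toLinearMap ((kugaSatakeModelInv Φ e).toLinearMap z) = z :=
  HodgeStructure.kugaSatakeOfFormEquivHom_inv_apply (H := hodgeStructure Φ 2) (H' := twoFormHodge Φ e)
    (intersectionQuad Φ e) (pluckerQuad (homologyFrame Φ e))
    (twoFormModel Φ e) 1 (pluckerQuad_twoFormModel_eq_one_mul Φ e) (comap_twoFormHodge_F Φ e)
    (isKugaSatakeAdmissible_hodgeStructure_two Φ e) (isKugaSatakeAdmissible_twoFormHodge Φ e) z

end KugaSatake

/-! ### §7 `H¹(X)` on `V = U^*`, the holomorphic one-forms `α, β`, and `σ = α ∧ β` in the model -/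

section Morrison

omit [LinearOrder ι] in
/-- `H¹(X, ℚ)` is reflexive (finite-dimensional): `eval : H¹ ≅ H¹^{**}`; recorded as an instance because
instance search through the normed hierarchy of the ambient form space does not find it in time. [folklore] -/
instance isReflexive_rationalForms_one : Module.IsReflexive ℚ (rationalForms Φ 1) :=
  haveI : Module.Free ℚ (rationalForms Φ 1) := Module.Free.of_divisionRing ℚ (rationalForms Φ 1)
  Module.IsReflexive.of_finite_of_free ℚ (rationalForms Φ 1)

/-- `U = H¹(X, ℚ)^*` is finite-dimensional (dual basis of the coordinate one-forms). [folklore] -/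
instance finite_dual_rationalForms_one : Module.Finite ℚ (Module.Dual ℚ (rationalForms Φ 1)) :=
  Module.Finite.of_basis (coordOneFormBasis Φ).dualBasis

/-- **`H¹(X, ℚ)` with its weight-one Hodge structure, read on `V = U^* = H¹(X, ℚ)^{**}`** (transport
along the canonical `Module.evalEquiv`; Huybrechts' `V` with `V^{1,0} = H^{1,0}(X)`).
[cite: Huybrechts2016K3, Ch. 4 §3.1, proof of Prop. 3.1] -/
def oneFormHodge : HodgeStructure (Module.Dual ℚ (Module.Dual ℚ (rationalForms Φ 1))) 1 :=
  (hodgeStructure Φ 1).comapEquiv (Module.evalEquiv ℚ (rationalForms Φ 1)).symm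

/-- `eval : H¹(X) → V` is a morphism (an isomorphism) of Hodge structures onto `oneFormHodge`.
[cite: Huybrechts2016K3, Ch. 4 §3.1, proof of Prop. 3.1] -/
def oneFormHodgeHom : HodgeStructure.Hom (hodgeStructure Φ 1) (oneFormHodge Φ) :=
  HodgeStructure.Hom.ofComapBaseChange (Module.evalEquiv ℚ (rationalForms Φ 1)) fun p ↦
    congrArg (fun H : HodgeStructure (rationalForms Φ 1) 1 ↦ H.F p)
      (HodgeStructure.comapEquiv_comapEquiv_symm (hodgeStructure Φ 1)
        (Module.evalEquiv ℚ (rationalForms Φ 1)))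

omit [LinearOrder ι] in
/-- Its underlying map is `eval`. [folklore] -/
private theorem oneFormHodgeHom_toLinearMap_apply (γ : rationalForms Φ 1) :
    (oneFormHodgeHom Φ).toLinearMap γ = Module.Dual.eval ℚ (rationalForms Φ 1) γ :=
  rfl

omit [LinearOrder ι] in
/-- The filtrations correspond under `eval ⊗ ℂ`. [folklore] -/
private theorem comap_oneFormHodge_F (p : ℤ) :
    ((oneFormHodge Φ).F p).comap ((oneFormHodgeHom Φ).toLinearMap.baseChange ℂ) =
      (hodgeStructure Φ 1).F p :=
  congrArg (fun H : HodgeStructure (rationalForms Φ 1) 1 ↦ H.F p)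
    (HodgeStructure.comapEquiv_comapEquiv_symm (hodgeStructure Φ 1)
      (Module.evalEquiv ℚ (rationalForms Φ 1)))

omit [LinearOrder ι] in
/-- `eval ⊗ ℂ` is surjective. [folklore] -/
private theorem baseChange_oneFormHodgeHom_surjective :
    Function.Surjective ((oneFormHodgeHom Φ).toLinearMap.baseChange ℂ) := by
  rw [LinearMap.baseChange_eq_ltensor]
  exact LinearMap.lTensor_surjective ℂ (Module.evalEquiv ℚ (rationalForms Φ 1)).surjective

omit [LinearOrder ι] in
/-- `eval ⊗ ℂ` is injective. [folklore] -/
private theorem baseChange_oneFormHodgeHom_injective :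
    Function.Injective ((oneFormHodgeHom Φ).toLinearMap.baseChange ℂ) := by
  rw [LinearMap.baseChange_eq_ltensor]
  exact Module.Flat.lTensor_preserves_injective_linearMap _
    (Module.evalEquiv ℚ (rationalForms Φ 1)).injective

omit [LinearOrder ι] in
/-- The filtration of `oneFormHodge` is the image of that of `H¹(X)` under `eval ⊗ ℂ`. [folklore] -/
private theorem oneFormHodge_F (p : ℤ) :
    (oneFormHodge Φ).F p =
      ((hodgeStructure Φ 1).F p).map ((oneFormHodgeHom Φ).toLinearMap.baseChange ℂ) := by
  rw [← comap_oneFormHodge_F Φ p,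
    Submodule.map_comap_eq_of_surjective (baseChange_oneFormHodgeHom_surjective Φ)]

/-- **The complexified model is multiplicative**: `(x ∪ y)' = x' ∧_ℂ y'` on `ℂ ⊗ H¹(X, ℚ)`, where
`x' = (eval ⊗ ℂ) x ∈ V_ℂ` (FILE 2c's `dualWedgeC`). [cite: Lange2023AbelianVarietiesComplex, §1.1.4 Prop. 1.1.20] -/
theorem baseChange_twoFormHodgeHom_cupProduct (e : Fin 4 ≃ ι) (h : 1 + 1 = 2)
    (x y : ℂ ⊗[ℚ] rationalForms Φ 1) :
    (twoFormHodgeHom Φ e).toLinearMap.baseChange ℂ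
        (HodgeStructure.bilinBaseChange (V := rationalForms Φ 1) (W := rationalForms Φ 1)
          (U := rationalForms Φ 2) (cupProduct Φ h) x y) =
      HodgeStructure.MorrisonSpinor.dualWedgeC ((oneFormHodgeHom Φ).toLinearMap.baseChange ℂ x)
        ((oneFormHodgeHom Φ).toLinearMap.baseChange ℂ y) := by
  induction x using TensorProduct.induction_on with
  | zero => simp only [LinearMap.map_zero, LinearMap.zero_apply]
  | add x₁ x₂ h₁ h₂ =>
    simp only [LinearMap.map_add, LinearMap.add_apply]
    exact congrArg₂ (· + ·) h₁ h₂
  | tmul c v =>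
    induction y using TensorProduct.induction_on with
    | zero => simp only [LinearMap.map_zero]
    | add y₁ y₂ h₁ h₂ =>
      simp only [LinearMap.map_add]
      exact congrArg₂ (· + ·) h₁ h₂
    | tmul d w =>
      rw [HodgeStructure.bilinBaseChange_tmul_tmul, LinearMap.baseChange_tmul,
        LinearMap.baseChange_tmul, LinearMap.baseChange_tmul,
        HodgeStructure.MorrisonSpinor.dualWedgeC_tmul_tmul, twoFormHodgeHom_toLinearMap_apply,
        twoFormModel_cupProduct, oneFormHodgeHom_toLinearMap_apply, oneFormHodgeHom_toLinearMap_apply]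

omit [LinearOrder ι] in
/-- `F¹ H¹(X) = H^{1,0}(X)` is the whole `(1,0)`-piece (weight one: `F⁰ = ⊤`). [cite: VoisinHodgeI2002, §7.2.2 (PDF p. 142)] -/
theorem piece_one_zero_eq_F_one : (hodgeStructure Φ 1).piece 1 0 = (hodgeStructure Φ 1).F 1 := by
  rw [HodgeStructure.piece_of_add_eq (hodgeStructure Φ 1) (p := 1) (q := 0) (by norm_num),
    hodgeStructure_F_of_nonpos Φ 1 le_rfl, HodgeStructure.complexConj_top, inf_top_eq]

omit [LinearOrder ι] in
/-- **`h^{1,0}(X) = 2`** for a two-dimensional complex torus: `dim F¹ H¹(X) = dim_ℂ E = 2`.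
[cite: Huybrechts2016K3, Ch. 3 §2.3 (PDF p. 59)] -/
theorem finrank_F_one_hodgeStructure_one (e : Fin 4 ≃ ι) :
    finrank ℂ ((hodgeStructure Φ 1).F 1) = 2 := by
  haveI := finiteDimensional_complex Φ
  rw [← piece_one_zero_eq_F_one]
  exact (hodgeNumber_hodgeStructure_one_zero Φ).trans (finrank_eq_two Φ e)

/-- A basis `(x₀, x₁)` of `H^{1,0}(X) = F¹ H¹(X)` (any one; Huybrechts: "let `α, β ∈ V^{1,0}` be a
basis"). [cite: Huybrechts2016K3, Ch. 4 §3.1, proof of Prop. 3.1] -/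
def fOneBasis (e : Fin 4 ≃ ι) : Basis (Fin 2) ℂ ((hodgeStructure Φ 1).F 1) :=
  Module.finBasisOfFinrankEq ℂ _ (finrank_F_one_hodgeStructure_one Φ e)

/-- **Huybrechts' `α, β ∈ V^{1,0}` in the model**: `αⱼ = (eval ⊗ ℂ)(xⱼ) ∈ V_ℂ = ℂ ⊗ U^*` for the basis
`(x₀, x₁)` of `H^{1,0}(X)`. [cite: Huybrechts2016K3, Ch. 4 §3.1, proof of Prop. 3.1] -/
def modelAlpha (e : Fin 4 ≃ ι) (j : Fin 2) :
    ℂ ⊗[ℚ] Module.Dual ℚ (Module.Dual ℚ (rationalForms Φ 1)) :=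
  (oneFormHodgeHom Φ).toLinearMap.baseChange ℂ ((fOneBasis Φ e j : (hodgeStructure Φ 1).F 1))

omit [LinearOrder ι] in
/-- `α, β` are linearly independent. [cite: Huybrechts2016K3, Ch. 4 §3.1, proof of Prop. 3.1] -/
theorem linearIndependent_modelAlpha (e : Fin 4 ≃ ι) :
    LinearIndependent ℂ ![modelAlpha Φ e 0, modelAlpha Φ e 1] := by
  have hvec : ![modelAlpha Φ e 0, modelAlpha Φ e 1] =
      (oneFormHodgeHom Φ).toLinearMap.baseChange ℂ ∘
        (((hodgeStructure Φ 1).F 1).subtype ∘ fOneBasis Φ e) := by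
    funext j
    fin_cases j <;> rfl
  rw [hvec]
  exact (((fOneBasis Φ e).linearIndependent.map' ((hodgeStructure Φ 1).F 1).subtype
    (Submodule.ker_subtype _))).map' _
      (LinearMap.ker_eq_bot.2 (baseChange_oneFormHodgeHom_injective Φ))

omit [LinearOrder ι] in
/-- `F¹ H¹(X) = span{x₀, x₁}`. [cite: Huybrechts2016K3, Ch. 4 §3.1, proof of Prop. 3.1] -/
theorem F_one_eq_span_fOneBasis (e : Fin 4 ≃ ι) :
    (hodgeStructure Φ 1).F 1 =
      Submodule.span ℂ {((fOneBasis Φ e 0 : (hodgeStructure Φ 1).F 1) : ℂ ⊗[ℚ] rationalForms Φ 1),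
        ((fOneBasis Φ e 1 : (hodgeStructure Φ 1).F 1) : ℂ ⊗[ℚ] rationalForms Φ 1)} := by
  have h := congrArg (Submodule.map ((hodgeStructure Φ 1).F 1).subtype) (fOneBasis Φ e).span_eq
  rw [Submodule.map_top, Submodule.range_subtype, Submodule.map_span, ← Set.range_comp] at h
  refine h.symm.trans ?_
  congr 1
  ext z
  simp only [Set.mem_range, Function.comp_apply, Set.mem_insert_iff, Set.mem_singleton_iff]
  constructor
  · rintro ⟨j, rfl⟩
    fin_cases j
    · exact Or.inl rfl
    · exact Or.inr rfl
  · rintro (rfl | rfl)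
    · exact ⟨0, rfl⟩
    · exact ⟨1, rfl⟩

omit [LinearOrder ι] in
/-- **`V^{1,0} = F¹ = span{α, β}`** for `H¹(X)` read on `V`. [cite: Huybrechts2016K3, Ch. 4 §3.1, proof of Prop. 3.1] -/
theorem oneFormHodge_F_one (e : Fin 4 ≃ ι) :
    (oneFormHodge Φ).F 1 = Submodule.span ℂ {modelAlpha Φ e 0, modelAlpha Φ e 1} := by
  rw [oneFormHodge_F, F_one_eq_span_fOneBasis Φ e, Submodule.map_span, Set.image_pair]
  rfl

omit [LinearOrder ι] in
/-- `F² = 0` for `H¹(X)` read on `V` (weight one, effective). [cite: VoisinHodgeI2002, §7.1.1 Def. 7.4 (PDF p. 132)] -/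
theorem oneFormHodge_F_two : (oneFormHodge Φ).F 2 = ⊥ := by
  rw [oneFormHodge_F, hodgeStructure_F_eq_bot Φ 1 (by norm_num), Submodule.map_bot]

/-- **`σ = α ∧ β ∈ (⋀²V)^{2,0}`** in the model — it is the image of `x₀ ∪ x₁ ∈ H^{2,0}(X)` (cup product
of `(1,0)`-classes, the tree's `bilinBaseChange_cupProduct_mem_piece`); with `h^{2,0} = 1` and
`α ∧ β ≠ 0` it spans. [cite: Huybrechts2016K3, Ch. 4 §3.1, proof of Prop. 3.1] -/
theorem dualWedgeC_modelAlpha_mem_piece (e : Fin 4 ≃ ι) :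
    HodgeStructure.MorrisonSpinor.dualWedgeC (modelAlpha Φ e 0) (modelAlpha Φ e 1) ∈
      (twoFormHodge Φ e).piece 2 0 := by
  have h0 : ((fOneBasis Φ e 0 : (hodgeStructure Φ 1).F 1) : ℂ ⊗[ℚ] rationalForms Φ 1) ∈
      (hodgeStructure Φ 1).piece 1 0 := by
    rw [piece_one_zero_eq_F_one]; exact Submodule.coe_mem _
  have h1 : ((fOneBasis Φ e 1 : (hodgeStructure Φ 1).F 1) : ℂ ⊗[ℚ] rationalForms Φ 1) ∈
      (hodgeStructure Φ 1).piece 1 0 := by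
    rw [piece_one_zero_eq_F_one]; exact Submodule.coe_mem _
  have hcup := bilinBaseChange_cupProduct_mem_piece Φ (show 1 + 1 = 2 from rfl) h0 h1
  rw [show (1 : ℤ) + 1 = 2 from rfl, show (0 : ℤ) + 0 = 0 from rfl] at hcup
  rw [modelAlpha, modelAlpha, ← baseChange_twoFormHodgeHom_cupProduct Φ e rfl,
    ← map_piece_eq_twoFormHodge_piece]
  exact Submodule.mem_map_of_mem hcup

/-! ### §8 `H¹(X̂) = H¹(X)^∨(-1)` on `U`: `F¹ = Ann{α, β}` -/

omit [LinearOrder ι] in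
/-- Double duality swap: `⟨(eval ⊗ ℂ) x, ξ⟩ = ⟨ξ, x⟩` for `x ∈ ℂ ⊗ H¹(X, ℚ)`, `ξ ∈ ℂ ⊗ U`. [folklore] -/
private theorem dualBaseChange_baseChange_eval (x : ℂ ⊗[ℚ] rationalForms Φ 1)
    (ξ : ℂ ⊗[ℚ] Module.Dual ℚ (rationalForms Φ 1)) :
    HodgeStructure.dualBaseChange (Module.Dual ℚ (rationalForms Φ 1))
        ((oneFormHodgeHom Φ).toLinearMap.baseChange ℂ x) ξ =
      HodgeStructure.dualBaseChange (rationalForms Φ 1) ξ x := by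
  induction x using TensorProduct.induction_on with
  | zero => simp only [LinearMap.map_zero, LinearMap.zero_apply]
  | add x₁ x₂ h₁ h₂ =>
    simp only [LinearMap.map_add, LinearMap.add_apply]
    exact congrArg₂ (· + ·) h₁ h₂
  | tmul c v =>
    induction ξ using TensorProduct.induction_on with
    | zero => simp only [LinearMap.map_zero, LinearMap.zero_apply]
    | add y₁ y₂ h₁ h₂ =>
      simp only [LinearMap.map_add, LinearMap.add_apply]
      exact congrArg₂ (· + ·) h₁ h₂
    | tmul d φ =>
      rw [LinearMap.baseChange_tmul, oneFormHodgeHom_toLinearMap_apply,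
        HodgeStructure.dualBaseChange_tmul_tmul, HodgeStructure.dualBaseChange_tmul_tmul,
        Module.Dual.eval_apply, mul_smul_comm, mul_smul_comm, mul_comm]

variable [HodgeTensorFacts.{uE, uE}]

omit [LinearOrder ι] in
/-- **`H¹(X̂, ℚ) = H¹(X, ℚ)^∨(-1)` on `U = H¹(X, ℚ)^*`** (the tree's `twistedDual`; it IS the Hodge
structure of the dual torus by A1-31's `dualCohomologyHom`): **`F¹ = Ann{α, β}`**.
[cite: Huybrechts2016K3, Ch. 4 §3.1, proof of Prop. 3.1] [cite: VoisinHodgeI2002, §7.2.2 (PDF p. 142)] -/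
theorem twistedDual_F_one (e : Fin 4 ≃ ι) :
    (hodgeStructure Φ 1).twistedDual.F 1 =
      LinearMap.ker (HodgeStructure.dualBaseChange (Module.Dual ℚ (rationalForms Φ 1))
          (modelAlpha Φ e 0)) ⊓
        LinearMap.ker (HodgeStructure.dualBaseChange (Module.Dual ℚ (rationalForms Φ 1))
          (modelAlpha Φ e 1)) := by
  ext ξ
  rw [HodgeStructure.mem_twistedDual_F_iff, show ((1 : ℕ) : ℤ) + 1 - 1 = 1 by norm_num,
    F_one_eq_span_fOneBasis Φ e, Submodule.mem_inf, LinearMap.mem_ker, LinearMap.mem_ker, modelAlpha,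
    modelAlpha, dualBaseChange_baseChange_eval, dualBaseChange_baseChange_eval]
  refine ⟨fun h ↦ ⟨h _ (Submodule.subset_span (Set.mem_insert _ _)),
      h _ (Submodule.subset_span (Set.mem_insert_of_mem _ (Set.mem_singleton _)))⟩, ?_⟩
  rintro ⟨h0, h1⟩ x hx
  refine Submodule.span_induction
    (p := fun x _ ↦ HodgeStructure.dualBaseChange (rationalForms Φ 1) ξ x = 0)
    (fun y hy ↦ ?_) (map_zero _) (fun a b _ _ ha hb ↦ by rw [map_add, ha, hb, add_zero])
    (fun c a _ ha ↦ by rw [map_smul, ha, smul_zero]) hx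
  rcases hy with hy | hy
  · rw [hy]; exact h0
  · rw [Set.mem_singleton_iff] at hy
    rw [hy]
    exact h1

omit [LinearOrder ι] in
/-- `F² = 0` for `H¹(X̂)` on `U`. [cite: DeligneHodgeII1971, 1.1.6] -/
theorem twistedDual_F_two : (hodgeStructure Φ 1).twistedDual.F 2 = ⊥ :=
  HodgeStructure.twistedDual_F_eq_bot _
    (by rw [show ((1 : ℕ) : ℤ) + 1 - 2 = 0 by norm_num]; exact hodgeStructure_F_of_nonpos Φ 1 le_rfl)

/-! ### §9 Morrison's theorem for the torus: `KS(X) ≅ Hom(V, H¹(X)) ⊕ Hom(U, H¹(X̂))` -/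

/-- `Ψ⁺ : KS(⋀²V, Q_{b_e}) → End(V) ⊕ End(V^*)` as a morphism of Hodge structures, for the model of the
torus (FILE 2c `kugaSatakeEndPairHom` fed with `α, β`, `σ = α ∧ β`, `F¹V = span{α,β}`, `F¹U = Ann{α,β}`).
[cite: Huybrechts2016K3, Ch. 4 §3.1, Prop. 3.1] -/
def modelEndPairHom [Invertible (2 : ℚ)] (e : Fin 4 ≃ ι) :
    HodgeStructure.Hom
      (HodgeStructure.kugaSatakeOfForm (twoFormHodge Φ e) (pluckerQuad (homologyFrame Φ e))
        (isKugaSatakeAdmissible_twoFormHodge Φ e))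
      (HodgeStructure.MorrisonSpinor.endPairHodgeStructure (oneFormHodge Φ)
        (hodgeStructure Φ 1).twistedDual) :=
  HodgeStructure.MorrisonSpinor.kugaSatakeEndPairHom (homologyFrame Φ e) (twoFormHodge Φ e)
    (isKugaSatakeAdmissible_twoFormHodge Φ e) (linearIndependent_modelAlpha Φ e)
    (dualWedgeC_modelAlpha_mem_piece Φ e) (oneFormHodge_F_one Φ e) (oneFormHodge_F_two Φ)
    (twistedDual_F_one Φ e) (twistedDual_F_two Φ)

/-- Its inverse `(Ψ⁺)⁻¹`. [cite: Huybrechts2016K3, Ch. 4 §3.1, Prop. 3.1] -/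
def modelEndPairInv [Invertible (2 : ℚ)] (e : Fin 4 ≃ ι) :
    HodgeStructure.Hom
      (HodgeStructure.MorrisonSpinor.endPairHodgeStructure (oneFormHodge Φ)
        (hodgeStructure Φ 1).twistedDual)
      (HodgeStructure.kugaSatakeOfForm (twoFormHodge Φ e) (pluckerQuad (homologyFrame Φ e))
        (isKugaSatakeAdmissible_twoFormHodge Φ e)) :=
  HodgeStructure.MorrisonSpinor.endPairKugaSatakeHom (homologyFrame Φ e) (twoFormHodge Φ e)
    (isKugaSatakeAdmissible_twoFormHodge Φ e) (linearIndependent_modelAlpha Φ e)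
    (dualWedgeC_modelAlpha_mem_piece Φ e) (oneFormHodge_F_one Φ e) (oneFormHodge_F_two Φ)
    (twistedDual_F_one Φ e) (twistedDual_F_two Φ)

/-- **Morrison's theorem (Huybrechts Prop. 3.1), Hodge-theoretic form, for a two-dimensional complex
torus `X`**: the composite `KS(X) ≅ KS(⋀²V, Q_{b_e}) ≅ End(V) ⊕ End(V^*)` is a morphism of weight-one
`ℚ`-Hodge structures from the Kuga–Satake structure of `X` (FILE 3) to Huybrechts'
`End(V) ⊕ End(V^*)` "with the Hodge structure of the target", the targets being `H¹(X)` (on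
`V = H¹(X, ℚ)^{**}`) and `H¹(X̂) = H¹(X)^∨(-1)` (on `U = V^*`): `KS(A) ∼ (A × Â)⁴` at the level of
rational Hodge structures (`Hom(ℚ⁴_triv, H) ≅ H⁴`). Inverse: `morrisonInv`.
[cite: Huybrechts2016K3, Ch. 4 §3.1, Prop. 3.1] -/
def morrisonHom [Invertible (2 : ℚ)] (e : Fin 4 ≃ ι) :
    HodgeStructure.Hom (kugaSatake Φ e)
      (HodgeStructure.MorrisonSpinor.endPairHodgeStructure (oneFormHodge Φ)
        (hodgeStructure Φ 1).twistedDual) :=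
  (modelEndPairHom Φ e).comp (kugaSatakeModelHom Φ e)

/-- The inverse `End(V) ⊕ End(V^*) → KS(X)`. [cite: Huybrechts2016K3, Ch. 4 §3.1, Prop. 3.1] -/
def morrisonInv [Invertible (2 : ℚ)] (e : Fin 4 ≃ ι) :
    HodgeStructure.Hom
      (HodgeStructure.MorrisonSpinor.endPairHodgeStructure (oneFormHodge Φ)
        (hodgeStructure Φ 1).twistedDual) (kugaSatake Φ e) :=
  (kugaSatakeModelInv Φ e).comp (modelEndPairInv Φ e)

/-- **`KS(X) ≅ Hom(V, H¹(X)) ⊕ Hom(U, H¹(X̂))` is an isomorphism of Hodge structures**: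
`morrisonInv ∘ morrisonHom = id`. [cite: Huybrechts2016K3, Ch. 4 §3.1, Prop. 3.1] -/
theorem morrisonInv_morrisonHom_apply [Invertible (2 : ℚ)] (e : Fin 4 ≃ ι)
    (z : CliffordAlgebra.even (M := rationalForms Φ 2) (intersectionQuad Φ e)) :
    (morrisonInv Φ e).toLinearMap ((morrisonHom Φ e).toLinearMap z) = z := by
  change (kugaSatakeModelInv Φ e).toLinearMap ((modelEndPairInv Φ e).toLinearMap
    ((modelEndPairHom Φ e).toLinearMap ((kugaSatakeModelHom Φ e).toLinearMap z))) = z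
  have h1 := HodgeStructure.MorrisonSpinor.endPairKugaSatakeHom_kugaSatakeEndPairHom_apply
    (homologyFrame Φ e) (twoFormHodge Φ e) (isKugaSatakeAdmissible_twoFormHodge Φ e)
    (linearIndependent_modelAlpha Φ e) (dualWedgeC_modelAlpha_mem_piece Φ e)
    (oneFormHodge_F_one Φ e) (oneFormHodge_F_two Φ) (twistedDual_F_one Φ e) (twistedDual_F_two Φ)
    ((kugaSatakeModelHom Φ e).toLinearMap z)
  exact (congrArg (kugaSatakeModelInv Φ e).toLinearMap h1).trans (kugaSatakeModelInv_hom_apply Φ e z)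

/-- `morrisonHom ∘ morrisonInv = id`. [cite: Huybrechts2016K3, Ch. 4 §3.1, Prop. 3.1] -/
theorem morrisonHom_morrisonInv_apply [Invertible (2 : ℚ)] (e : Fin 4 ≃ ι)
    (w : Module.End ℚ (Module.Dual ℚ (Module.Dual ℚ (rationalForms Φ 1))) ×
      Module.End ℚ (Module.Dual ℚ (rationalForms Φ 1))) :
    (morrisonHom Φ e).toLinearMap ((morrisonInv Φ e).toLinearMap w) = w := by
  change (modelEndPairHom Φ e).toLinearMap ((kugaSatakeModelHom Φ e).toLinearMap
    ((kugaSatakeModelInv Φ e).toLinearMap ((modelEndPairInv Φ e).toLinearMap w))) = w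
  have h1 := kugaSatakeModelHom_inv_apply Φ e ((modelEndPairInv Φ e).toLinearMap w)
  have h2 := HodgeStructure.MorrisonSpinor.kugaSatakeEndPairHom_endPairKugaSatakeHom_apply
    (homologyFrame Φ e) (twoFormHodge Φ e) (isKugaSatakeAdmissible_twoFormHodge Φ e)
    (linearIndependent_modelAlpha Φ e) (dualWedgeC_modelAlpha_mem_piece Φ e)
    (oneFormHodge_F_one Φ e) (oneFormHodge_F_two Φ) (twistedDual_F_one Φ e) (twistedDual_F_two Φ) w
  exact (congrArg (modelEndPairHom Φ e).toLinearMap h1).trans h2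

end Morrison






end ComplexTorus

end Literature.Geometry.Kaehler

end
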